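import Literature.AlgebraicGeometry.HodgeTheory.DworkSexticSingletonRankOfTransport
import Literature.AlgebraicGeometry.HodgeTheory.DirectImageEndomorphism
import HarnessLib

/-!
# The equivariant transport to the Fermat point from a `Γ_W`-family through `X_ψ` and `X⁴₆`
# (Katz 2009, Lemma 3.1(1): "the eigensheaves are local systems")

Family `hodge`, layer `Literature/AlgebraicGeometry/HodgeTheory`; sequel to
`DworkSexticSingletonRankOfTransport`, whose theorem `singleton_rank_le_one_of_equivariant_transport`
derives Katz's rank bound `dim V_{(1,2,3,3,4,5)∘σ}(X_ψ) ≤ 1` from a `Γ_W`-equivariant injective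
`ℂ`-linear map `T : H⁴(X_ψ(ℂ); ℂ) → H⁴(X⁴₆(ℂ); ℂ)` taken as a hypothesis. Written for crux K2
(stmt-HodgeConjecture-20241) of route `HodgeConjecture/DworkReflectionQuotients`.

THIS FILE discharges the topology of that hypothesis from the tree's parallel transport
(`DirectImageTransport`: `transportFun` in `Rᵏ π_* ℂ` over a cohomologically locally trivial locus
`U`, `ℂ`-linear, invertible along the reverse path; `DirectImageEndomorphism`:
`transportFun_map_fiberHom`, transport commutes with endomorphisms of the family over the base —
Voisin II §3.1.2), leaving as hypotheses exactly the GEOMETRIC data that the tree does not yet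
construct (Katz 2009 §3: "the group `Γ_W` acts as automorphisms of `𝕏/𝔸¹`"):

* a family `π : 𝒳 ⟶ S` of `ℂ`-schemes and a locus `U ⊆ S(ℂ)` over which it is cohomologically
  locally trivial (for a proper smooth family over a smooth base this is Ehresmann's theorem, in
  the tree for the universal hypersurface: `isCohomologicallyLocallyTrivialOn_family`);
* for each `a ∈ Γ_W` an endomorphism `G a : 𝒳 ⟶ 𝒳` OVER THE BASE (`G a ≫ π = π`) with its fibre
  maps `gf a t : 𝒳_t ⟶ 𝒳_t` (`gf a t ≫ ι_t = ι_t ≫ G a`; they exist uniquely,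
  `exists_fiberHom_comp_fiberι`, `fiberHom_unique`);
* two points `s₁, s₂ ∈ U` joined by a path in `U`, and isomorphisms of `ℂ`-schemes
  `e₁ : 𝒳_{s₁} ≅ X_ψ`, `e₂ : 𝒳_{s₂} ≅ X⁴₆` conjugating `gf a sᵢ` to the diagonal automorphisms
  `diagonalAut` of the two sextics (`Γ_W ≤ diagonalStabilizer` of both forms).

From these, `exists_equivariant_transport_of_family` produces the map `T = (e₂⁻¹)^* ∘ γ_* ∘ e₁^*`,
injective and `Γ_W`-equivariant, and `singleton_rank_le_one_of_family` concludes
`V_{χ_{(1,2,3,3,4,5)∘σ}}(X_ψ) ≤ ℂ·v` — the rank hypothesis of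
`flatClasses_mem_span_reflInvariant_singleton_of_rank_le_one` (`DworkSexticSingletonPurity`). What
remains for the 360 singleton flat classes of crux K2 is therefore the CONSTRUCTION of such a family
with its `Γ_W`-action (e.g. the base change of the universal family of sextics
`UniversalHypersurface.family ℂ 4 6` to the `Γ_W`-invariant forms `Σ cᵢ xᵢ⁶ + c ∏ xᵢ`, or the Dwork
pencil itself over `𝔸¹ ∖ μ₆`), nothing Hodge-theoretic. No named fact is introduced.

## References

* [Katz2009] N. M. Katz, Another look at the Dwork family, Progr. Math. 270 (2009), §3 p. 92,
  Lemma 3.1(1) (proof, p. 8).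
* [VoisinHodgeI2002] C. Voisin, Hodge Theory and Complex Algebraic Geometry I (2002), Thm. 9.3, §9.2.1.
* [VoisinHodgeII2003] C. Voisin, Hodge Theory and Complex Algebraic Geometry II (2003), §3.1.2.
-/

noncomputable section

open CategoryTheory
open scoped BigOperators

namespace Literature.AlgebraicGeometry.HodgeTheory.DworkSextic

open Literature.AlgebraicGeometry.Motives Literature.AlgebraicTopology.SingularHomology

section Family

variable {𝒳 S : SchemeOver ℂ} (π : 𝒳 ⟶ S) {U : Set (ComplexPoints S)}
  (hU : IsCohomologicallyLocallyTrivialOn π U) {s₁ s₂ : U} (γ : Path.Homotopic.Quotient s₁ s₂)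
  (G : gammaW → (𝒳 ⟶ 𝒳)) (hG : ∀ a, G a ≫ π = π)
  (gf : ∀ (a : gammaW) (t : ComplexPoints S), fiberOver π t ⟶ fiberOver π t)
  (hgf : ∀ a t, gf a t ≫ fiberι π t = fiberι π t ≫ G a)
  {ψ : ℂ} (e₁ : fiberOver π s₁.1 ≅ fibre ψ) (e₂ : fiberOver π s₂.1 ≅ fermatHypersurface 4 6)
  (he₁ : ∀ a : gammaW,
    gf a s₁.1 ≫ e₁.hom = e₁.hom ≫ diagonalAut (form ψ) (gammaW_le_diagonalStabilizer ψ a.2))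
  (he₂ : ∀ a : gammaW,
    gf a s₂.1 ≫ e₂.hom = e₂.hom ≫ diagonalAut (fermatPolynomial ℂ 4 6) (gammaW_le_diagonalStabilizer_fermat a.2))

include hU γ hG hgf he₁ he₂ in
/-- **The equivariant transport to the Fermat point, from a `Γ_W`-family.** Given a family
`π : 𝒳 ⟶ S`, cohomologically locally trivial over `U ∋ s₁, s₂`, a path `γ` from `s₁` to `s₂` in `U`,
endomorphisms `G a` of `𝒳` over `S` (`a ∈ Γ_W`) with fibre maps `gf a t`, and isomorphisms
`e₁ : 𝒳_{s₁} ≅ X_ψ`, `e₂ : 𝒳_{s₂} ≅ X⁴₆` conjugating the `gf a` to the diagonal automorphisms `g_a`: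
the map `T = (e₂⁻¹)^* ∘ γ_* ∘ e₁^* : H⁴(X_ψ(ℂ); ℂ) → H⁴(X⁴₆(ℂ); ℂ)` is `ℂ`-linear, injective
(transport back along `γ⁻¹`), and `Γ_W`-equivariant, `T ∘ g_a^* = g_a^* ∘ T` (transport commutes
with endomorphisms over the base, `transportFun_map_fiberHom`). This is the input `T` of
`singleton_rank_le_one_of_equivariant_transport`. [cite: Katz2009, §3 p. 92 and Lemma 3.1 (proof)]
[cite: VoisinHodgeII2003, §3.1.2] [cite: VoisinHodgeI2002, §9.2.1] -/
theorem exists_equivariant_transport_of_family :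
    ∃ T : complexBetti (fibre ψ) (2 * 2) →ₗ[ℂ] complexBetti (fermatHypersurface 4 6) (2 * 2),
      Function.Injective T ∧
      ∀ (a : gammaW) (c : complexBetti (fibre ψ) (2 * 2)),
        T (singularCohomology.map ℂ ℂ (diagonalMap (form ψ) (gammaW_le_diagonalStabilizer ψ a.2)) (2 * 2) c) =
          singularCohomology.map ℂ ℂ
            (diagonalMap (fermatPolynomial ℂ 4 6) (gammaW_le_diagonalStabilizer_fermat a.2)) (2 * 2) (T c) := by
  refine ⟨(complexBetti.map e₂.inv (2 * 2)).hom ∘ₗ transportLinear π (2 * 2) hU γ ∘ₗ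
    (complexBetti.map e₁.hom (2 * 2)).hom, ?_, fun a c => ?_⟩
  · -- injectivity: each factor has a left inverse
    have h₁ : Function.Injective (complexBetti.map e₁.hom (2 * 2)) := fun x y hxy => by
      have h := congrArg (complexBetti.map e₁.inv (2 * 2)) hxy
      rwa [← complexBetti.map_comp_apply', ← complexBetti.map_comp_apply', e₁.inv_hom_id,
        complexBetti.map_id] at h
    have h₂ : Function.Injective (transportFun π (2 * 2) hU γ) := fun x y hxy => by
      have h := congrArg (transportFun π (2 * 2) hU γ.symm) hxy
      rwa [← transportFun_trans, ← transportFun_trans, Path.Homotopic.Quotient.trans_symm,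
        transportFun_refl, transportFun_refl] at h
    have h₃ : Function.Injective (complexBetti.map e₂.inv (2 * 2)) := fun x y hxy => by
      have h := congrArg (complexBetti.map e₂.hom (2 * 2)) hxy
      rwa [← complexBetti.map_comp_apply', ← complexBetti.map_comp_apply', e₂.hom_inv_id,
        complexBetti.map_id] at h
    intro x y hxy
    simp only [LinearMap.coe_comp, Function.comp_apply, transportLinear_apply] at hxy
    exact h₁ (h₂ (h₃ hxy))
  · -- equivariance
    simp only [LinearMap.coe_comp, Function.comp_apply, transportLinear_apply]
    have hψ' : singularCohomology.map ℂ ℂ (diagonalMap (form ψ) (gammaW_le_diagonalStabilizer ψ a.2))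
        (2 * 2) c = complexBetti.map (diagonalAut (form ψ) (gammaW_le_diagonalStabilizer ψ a.2)) (2 * 2) c :=
      rfl
    have hF' : ∀ y, singularCohomology.map ℂ ℂ
        (diagonalMap (fermatPolynomial ℂ 4 6) (gammaW_le_diagonalStabilizer_fermat a.2)) (2 * 2) y =
          complexBetti.map (diagonalAut (fermatPolynomial ℂ 4 6) (gammaW_le_diagonalStabilizer_fermat a.2))
            (2 * 2) y := fun _ => rfl
    have hcomm : e₂.inv ≫ gf a s₂.1 =
        diagonalAut (fermatPolynomial ℂ 4 6) (gammaW_le_diagonalStabilizer_fermat a.2) ≫ e₂.inv := by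
      rw [Iso.inv_comp_eq, ← Category.assoc, ← he₂ a, Category.assoc, Iso.hom_inv_id, Category.comp_id]
    rw [hψ', hF', ← complexBetti.map_comp_apply', ← he₁ a, complexBetti.map_comp_apply',
      transportFun_map_fiberHom π (2 * 2) hU (G a) (hG a) (gf a) (hgf a) γ,
      ← complexBetti.map_comp_apply', ← complexBetti.map_comp_apply', hcomm]

include hU γ hG hgf he₁ he₂ in
/-- **Katz's rank bound for the singleton type from a `Γ_W`-family through `X_ψ` and `X⁴₆`**: under
the hypotheses of `exists_equivariant_transport_of_family`, every eigenspace
`V_{χ_{(1,2,3,3,4,5)∘σ}} ⊆ H⁴(X_ψ(ℂ); ℂ)` lies in a line (`singleton_rank_le_one_of_equivariant_transport`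
with the transport just constructed) — the rank hypothesis of
`flatClasses_mem_span_reflInvariant_singleton_of_rank_le_one`. [cite: Katz2009, Lemma 3.1(1)]
[cite: VoisinHodgeI2002, §9.2.1] -/
theorem singleton_rank_le_one_of_family (σ : Equiv.Perm (Fin 6)) :
    ∃ v, diagonalCharacterEigenspace (form ψ) gammaW (character fun k => flatTypes 0 (σ k)) (2 * 2) ≤
      ℂ ∙ v := by
  obtain ⟨T, hT, hTeq⟩ := exists_equivariant_transport_of_family π hU γ G hG gf hgf e₁ e₂ he₁ he₂
  exact singleton_rank_le_one_of_equivariant_transport T hT hTeq σ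

end Family

end Literature.AlgebraicGeometry.HodgeTheory.DworkSextic

end
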